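import Literature.Analysis.Calculus.ConePoincareHomotopy
import Mathlib.Analysis.Normed.Module.FiniteDimension
import Mathlib.Topology.MetricSpace.ProperSpace
import HarnessLib

/-!
# The cone homotopy operator on finite-dimensional spaces: the local bounds are automatic

Complements to `ConePoincareHomotopy.lean`.  The analytic statements there
(`hasFDerivAt_conePrimitive`, the homotopy formula
`extDeriv_conePrimitive_add_conePrimitive_extDeriv_apply`) carry an explicit hypothesis: a uniform
bound of the form and of its derivative over the cones on a ball.  On a FINITE-DIMENSIONAL space this
bound is automatic for forms continuous on an open star-shaped set (the cones over a closed ball form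
a compact subset of the set, `exists_bound_on_cones`, `exists_ball_bound_on_cones`), which gives the
hypothesis-free versions used downstream:

* `hasFDerivAt_conePrimitive'`, `extDeriv_conePrimitive_add'` (the homotopy formula `d h + h d = 1`)
  and `extDeriv_conePrimitive_of_closed'` (closed `C¹` forms on open star-shaped sets are exact, with
  the cone primitive).

Theorems only, no `sorry`. [cite: Spivak1965, Thm. 4-11]

## References

* M. Spivak, *Calculus on Manifolds* (1965), Thm. 4-11. [Spivak1965]
-/

noncomputable section

open Set MeasureTheory intervalIntegral Filter Topology
open scoped Interval

namespace Literature.Analysis.Calculus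

variable {E F : Type*} [NormedAddCommGroup E] [NormedSpace ℝ E] [NormedAddCommGroup F] [NormedSpace ℝ F]
  {n : ℕ}

/-! ### Compactness of the cones over a closed ball -/

/-- **Uniform bound over the cones on a closed ball.**  On a proper (e.g. finite-dimensional) space,
a function continuous on a set `X` star-shaped with respect to `x₀` is bounded on the union of the
segments `[x₀, y']`, `y'` in a closed ball contained in `X` (a compact subset of `X`). [folklore] -/
theorem exists_bound_on_cones [ProperSpace E] {G : Type*} [NormedAddCommGroup G] {g : E → G} {X : Set E}
    {x₀ : E} (hX : StarConvex ℝ x₀ X) (hg : ContinuousOn g X) {y : E} {r : ℝ}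
    (hball : Metric.closedBall y r ⊆ X) :
    ∃ C, ∀ y' ∈ Metric.closedBall y r, ∀ t ∈ Icc (0 : ℝ) 1, ‖g (conePt x₀ y' t)‖ ≤ C := by
  set S : Set E := (fun p : ℝ × E => conePt x₀ p.2 p.1) '' (Icc (0 : ℝ) 1 ×ˢ Metric.closedBall y r) with hS
  have hSc : IsCompact S := by
    refine (isCompact_Icc.prod (isCompact_closedBall y r)).image ?_
    exact (continuous_const.add ((continuous_fst).smul (continuous_snd.sub continuous_const)))
  have hSX : S ⊆ X := by
    rintro _ ⟨⟨t, y'⟩, ⟨ht, hy'⟩, rfl⟩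
    exact conePt_mem hX (hball hy') ht
  obtain ⟨C, hC⟩ := hSc.exists_bound_of_continuousOn (hg.mono hSX)
  refine ⟨C, fun y' hy' t ht => hC _ ⟨⟨t, y'⟩, ⟨ht, hy'⟩, rfl⟩⟩

/-- The two-function version on an OPEN star-shaped set: a ball at `y ∈ X` inside `X` with a common
bound for `ω` and `ω'` over its cones. [folklore] -/
theorem exists_ball_bound_on_cones [ProperSpace E] {G G' : Type*} [NormedAddCommGroup G] [NormedAddCommGroup G']
    {g : E → G} {g' : E → G'} {X : Set E} {x₀ : E} (hXo : IsOpen X) (hX : StarConvex ℝ x₀ X)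
    (hg : ContinuousOn g X) (hg' : ContinuousOn g' X) {y : E} (hy : y ∈ X) :
    ∃ r C, 0 < r ∧ Metric.ball y r ⊆ X ∧
      ∀ y' ∈ Metric.ball y r, ∀ t ∈ Icc (0 : ℝ) 1, ‖g (conePt x₀ y' t)‖ ≤ C ∧ ‖g' (conePt x₀ y' t)‖ ≤ C := by
  obtain ⟨r, hr, hball⟩ := Metric.nhds_basis_closedBall.mem_iff.1 (hXo.mem_nhds hy)
  obtain ⟨C, hC⟩ := exists_bound_on_cones hX hg hball
  obtain ⟨C', hC'⟩ := exists_bound_on_cones hX hg' hball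
  refine ⟨r, max C C', hr, Metric.ball_subset_closedBall.trans hball, fun y' hy' t ht => ⟨?_, ?_⟩⟩
  · exact (hC y' (Metric.ball_subset_closedBall hy') t ht).trans (le_max_left _ _)
  · exact (hC' y' (Metric.ball_subset_closedBall hy') t ht).trans (le_max_right _ _)

/-! ### Hypothesis-free versions -/

variable [FiniteDimensional ℝ E]

/-- **Derivative of the cone operator** (finite-dimensional `E`, no explicit bound).
[cite: Spivak1965, Thm. 4-11] -/
theorem hasFDerivAt_conePrimitive' {ω : E → E [⋀^Fin (n + 1)]→L[ℝ] F} {ω' : E → E →L[ℝ] E [⋀^Fin (n + 1)]→L[ℝ] F}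
    {X : Set E} {x₀ : E} (hXo : IsOpen X) (hX : StarConvex ℝ x₀ X) (hd : ∀ x ∈ X, HasFDerivAt ω (ω' x) x)
    (hc : ContinuousOn ω X) (hc' : ContinuousOn ω' X) {y : E} (hy : y ∈ X) :
    HasFDerivAt (conePrimitive x₀ ω) (∫ t in (0 : ℝ)..1, coneDerivIntegrand x₀ ω ω' y t) y := by
  haveI : ProperSpace E := FiniteDimensional.proper ℝ E
  obtain ⟨r, C, hr, hball, hC⟩ := exists_ball_bound_on_cones (G' := E →L[ℝ] E [⋀^Fin (n + 1)]→L[ℝ] F) hXo hX hc hc' hy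
  exact hasFDerivAt_conePrimitive hX hd hc hc' hr hball hC

omit [FiniteDimensional ℝ E] in
/-- **The homotopy formula `d(hω) + h(dω) = ω`** on an open star-shaped subset of a finite-dimensional
space, for `ω` of class `C¹`. [cite: Spivak1965, Thm. 4-11] -/
theorem extDeriv_conePrimitive_add' [FiniteDimensional ℝ E] [CompleteSpace F]
    {ω : E → E [⋀^Fin (n + 1)]→L[ℝ] F} {ω' : E → E →L[ℝ] E [⋀^Fin (n + 1)]→L[ℝ] F}
    {X : Set E} {x₀ : E} (hXo : IsOpen X) (hX : StarConvex ℝ x₀ X) (hd : ∀ x ∈ X, HasFDerivAt ω (ω' x) x)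
    (hc : ContinuousOn ω X) (hc' : ContinuousOn ω' X) {y : E} (hy : y ∈ X) (v : Fin (n + 1) → E) :
    extDeriv (conePrimitive x₀ ω) y v + conePrimitive x₀ (extDeriv ω) y v = ω y v := by
  haveI : ProperSpace E := FiniteDimensional.proper ℝ E
  obtain ⟨r, C, hr, hball, hC⟩ := exists_ball_bound_on_cones (G' := E →L[ℝ] E [⋀^Fin (n + 1)]→L[ℝ] F) hXo hX hc hc' hy
  exact extDeriv_conePrimitive_add_conePrimitive_extDeriv_apply hX hd hc hc' hr hball hC v

omit [FiniteDimensional ℝ E] in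
/-- **Poincaré lemma** on an open star-shaped subset of a finite-dimensional space: a closed `C¹` form
is the exterior derivative of its cone primitive. [cite: Spivak1965, Thm. 4-11] -/
theorem extDeriv_conePrimitive_of_closed' [FiniteDimensional ℝ E] [CompleteSpace F]
    {ω : E → E [⋀^Fin (n + 1)]→L[ℝ] F} {ω' : E → E →L[ℝ] E [⋀^Fin (n + 1)]→L[ℝ] F}
    {X : Set E} {x₀ : E} (hXo : IsOpen X) (hX : StarConvex ℝ x₀ X) (hd : ∀ x ∈ X, HasFDerivAt ω (ω' x) x)
    (hc : ContinuousOn ω X) (hc' : ContinuousOn ω' X) (hclosed : ∀ x ∈ X, extDeriv ω x = 0)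
    {y : E} (hy : y ∈ X) : extDeriv (conePrimitive x₀ ω) y = ω y := by
  haveI : ProperSpace E := FiniteDimensional.proper ℝ E
  obtain ⟨r, C, hr, hball, hC⟩ := exists_ball_bound_on_cones (G' := E →L[ℝ] E [⋀^Fin (n + 1)]→L[ℝ] F) hXo hX hc hc' hy
  exact extDeriv_conePrimitive_of_closed hX hd hc hc' hclosed hr hball hC

end Literature.Analysis.Calculus

end
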